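import Summits.ABC.IUTFork.DAGC312zj
import Summits.ABC.IUTFork.Conditional.AbcOfSHwBadMReyssatHolds
import Summits.ABC.IUTFork.Conditional.AbcOfSGenuineMChosenDepthRadRowsReyssat
import Summits.ABC.IUTFork.Conditional.AbcOfSHwBadMOfRefutedReyssat
import Summits.ABC.IUTFork.Conditional.AbcOfSlotLicenceGenuineKDegOne
import HarnessLib

/-!
# Kernel DAG index — layer C312, part zk (Δ23): APEX STATUS CENSUS v15 — FINDINGS OF RECORD §Q «C:HSHW-M-REF» BY NAME: (P6) is a kernel THEOREM at
# the Reyssat triple too, so the M window binder is refuted AS TYPED with NO hypothesis — the M twin of §P; K and M window families are now both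
# composition records with a false hypothesis at known data (one FQN for letter K2)

index Δ23 · abc-iut-c312-2 gen 7 (filer) per HOME/plan/KERNEL-DAG-SPEC.md v1.3 §4 (3) (apex duty of the index) and the one-name census pattern of
`DAG.apex_status_v12/v13/v14` (DAGC312zh/zi/zj, Δ20–Δ22). APPEND-ONLY; PROOF-ONLY (no `def`, no new `Prop`, no instance). THIS FILE PROVES NOTHING NEW:
it conjoins the STATEMENTS of landed theorems (`PartC312k.StatementOf @thm`) and proves the conjunction by the tuple of those theorems.

WHAT `apex_status_v15` RECORDS (each conjunct is a theorem ALREADY in the tree, cited by name; ns `Summit.ABC.IUTFork.` omitted; words = abc-iut-plan g10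
HOME/FINDINGS-OF-RECORD.md v3.0.4 §Q EVENT ROW «C:HSHW-M-REF», appended 2026-08-27T02:03:52Z — rulings C-R62/C-R69/C-R73/C-R73′; RQ7 PASS aud-16/E-ref-3 (p482049) ·
aud-22 (p483052) · aud-14 (p483704, p482354); identity junction abc-iut-C-cert-2 g5 «(M) REYSSAT l = 13, FULL: PASS» 01:52:47Z; Q4 names `DAG.apex_status_v14` as the apex
book the row is read against — this file is its successor):
(0) `DAG.apex_status_v14` (Δ22, p479146) — CARRIED verbatim (v13/v12 inside: records K explicit 3 · stable 2 · leanest 1 · γ-read 1; §P: K window binder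
    refuted as typed with no hypothesis at (λ₃₆₇₇, 13); §O: the typed per-image form (P) true as typed at known data);
§Q (1) `Conditional.FreyP6Reyssat.condP6_thirteen` · `condP6_seventeen` · `condP6_nineteen` · `condP6_reyssat_of_le_149` (abc-iut-w6-d102 g5, p482354; «C:P6-REYSSAT»,
    path of record per C-R73′) — [IUTchIV] Cor. 2.2 (ii) (P6) at P = ratPoint (2/23⁵) (the Reyssat abc triple 2 + 3¹⁰·109 = 23⁵) IS A KERNEL THEOREM at l = 13,
    17, 19 and at every prime 7 ≤ l ≤ 149 off {23, 109} (fact-free: Frobenius certificates of E₁ at p = 7 (#Ẽ(𝔽₇) = 8, a₇ = 0), 19, 41 + the Tate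
    transvection at the multiplicative prime 109 + degree transport [F : ℚ] ∣ 46080);
§Q (2) `Conditional.not_hSHwBad_M_reyssat_thirteen` (abc-iut-C-cert-3 g4, p483052 `AbcOfSHwBadMReyssatApex`) — the M WINDOW binder `hSHwBad` of
    `abc_of_SH_v11M_window_szpiroBadAll` (p453767, TYPE VERBATIM = the conclusion of the M socket `not_hSHwBad_M_of_refuted` p468391 §1; θ-parent p461893)
    is FALSE at (ratPoint (2/23⁵), 13) MODULO ONLY (P6), fed by: admissibility AS TYPED and the Szpiro-bad guard VERBATIM (`ReyssatM.mem_UP/admitsCore/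
    condP2/condP5/szpiroBad`: one integer inequality 63⁷⁰²·109³³⁴ < 3¹¹⁹⁶·23³⁴⁶·20⁷⁰² with π < 3.15), the M-SHALLOWNESS of every member
    (`Conditional.ReyssatM.not_exists_deep_thirteen`, p482049 `AbcOfSHwBadMShallowReyssat`; RQ7 PASS aud-16 01:28:22Z / E-ref-3 01:27:18Z) and abc-iut-W-num-6's
    UNCONDITIONAL M-line RAD refutation over 23 `Conditional.GenuineM.not_pilotKummerCompatHull_reyssat_le_19_rad` (p477727);
§Q (3) `Conditional.not_hSHwBad_M_reyssat_thirteen_holds` (C-cert-3 g4, p483704 `AbcOfSHwBadMReyssatHolds`; RQ7 aud-14 PASS FAITHFUL 01:43:23Z; junction PASS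
    01:52:47Z) — (2) at the theorem (1): the M window binder is FALSE for EVERY family of the free context binders and Kummer data, with
    NO hypothesis — the M twin of §P's `not_hSHwBad_frey_holds` (p477209). Hence the M WINDOW FAMILY p445989 → p453767 is, at this (datum, l), a set of
    COMPOSITION RECORDS WITH A FALSE HYPOTHESIS, exactly like the K family since §P (Q2 words of record). PAIR BOOKING (C-R69 (3), C-SCOREBOARD §3c;
    complements v14 §P (3), does not replace it): at (λ₃₆₇₇, 11/13/17) the M binder is LIVE-UNENGAGED (every genuine datum has an M-DEEP member,
    `FreyTier1.exists_deepM`) while at (Reyssat, 13) it is ENGAGED-AND-REFUTED — the two censuses are disjoint by construction;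
§Q (4) the inputs of (2) BY NAME, so that letter-K2 readers find them under one name: `Conditional.ReyssatM.not_exists_deep_thirteen` ·
    `Conditional.GenuineM.not_pilotKummerCompatHull_reyssat_le_19_rad` · `Conditional.ReyssatM.szpiroBad` · abc-iut-W-num-6 g2's eight-input template
    `Conditional.not_hSHwBad_M_of_reyssat_thirteen_inputs` (p479897; the same assembly with the inputs named; aud-16 PASS FAITHFUL);
§Q (5) Q4's concurrent closure, BY NAME: the d_mod = 1 picture CLOSED on both lines by theorem (C-R69′; record counts unchanged) —
    `Conditional.GenuineKSlot.cor312PerImageOf_of_not_slotLicence_of_orNum_of_dmod_eq_one` (abc-iut-C-cert-2 g4, p479622).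
K2 READING AFTER Δ23 (numbers, no verdict): record/companion hypothesis-list lengths UNCHANGED (K 3 · stable 2 · leanest 1 · γ-read 1; M leanest/joint/
γ-read 1/1/1 — plan/C-SCOREBOARD §5); REFUTED AS TYPED WITH NO HYPOTHESIS at a genuine datum: K `hSHwBad`/`hSHw` at (λ₃₆₇₇, 13) [§P] AND NOW M `hSHwBad_M`
at (Reyssat, 13) [§Q] (+ carried hreg, hvol, un-windowed hSH); the θ-content records (K p460293, M p461893: same binders on the CONTENT locus) and the
number-level binders hNumC · hNumJointC · hNumPOffC · hregC (K) / their M twins are neither refuted nor discharged as typed (their loci carry no known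
datum; «open of abc-type», C-R52); INHABITED AS TYPED: S_H at tame shallow data (v13 (6)(6′)), the per-image form (P) at known data (§O).

HONEST FRAMING: statements about OUR typed objects (the sharp M setting's per-label licence is STRONGER than print's Step (xi-f), abc-iut-w5-d107's
framing adopted cell-wide); «refuted as typed» ≠ «refuted in print»; (P6) is classical arithmetic of one elliptic curve over ℚ — its kernel discharge
removes an assumption of OUR certificates, it does not adjudicate IUT; a cut, a junction or an index knit discharges nothing. Nothing here asserts that
abc is proved or refuted or takes a side on [IUTchIII] Cor. 3.12 / [IUTchIV] Thm. 1.10, on the readings (U)/(P), or on any author (Mochizuki /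
Scholze–Stix / Joshi / Dupuy–Hilado). typed ≠ discharged; indexed ≠ endorsed. Co-import (fresh scan, HOME/staging/c312/c312-2/gen7/F1-SIDES-latest.txt):
side B of breaker F1 and of F-w5d064-1 like DAGC312zh/zi/zj; no import on side A. [claim: Mochizuki2012, status: disputed]
[cite: Mochizuki2012, IUTchIII Cor. 3.12 p. 173–174, Step (xi-f) p. 184; IUTchIV Thm. 1.10 pp. 22–31, Cor. 2.2 (ii) (P2)(P5)(P6) pp. 43–46]
[cite: MochizukiGenEll2010, Ex. 1.3 (i) p. 5, Def. 3.3 p. 12]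
-/

noncomputable section

namespace Summit.ABC.IUTFork.DAG

open PartC312k  -- `StatementOf h` := the statement of which `h` is the proof (landed in DAGC312k; re-types nothing, no new definition here)

/-- **APEX STATUS CENSUS v15 (Δ23; one FQN for letter K2).** The conjunction, BY NAME, of: (0) `DAG.apex_status_v14` (Δ22, carried);
§Q (1) `Conditional.FreyP6Reyssat.condP6_thirteen/seventeen/nineteen` + `condP6_reyssat_of_le_149` — (P6) at ratPoint (2/23⁵) is a kernel THEOREM
(p482354, fact-free Frobenius certificates); (2) `Conditional.not_hSHwBad_M_reyssat_thirteen` — the M window binder `hSHwBad_M` (p453767 verbatim) is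
FALSE at (Reyssat, 13) modulo only (P6) (p483052); (3) `Conditional.not_hSHwBad_M_reyssat_thirteen_holds` — the same with NO hypothesis (p483704: (2) at
the theorem (1)); (4) its inputs `ReyssatM.not_exists_deep_thirteen` (p482049) · `GenuineM.not_pilotKummerCompatHull_reyssat_le_19_rad` (p477727) ·
`ReyssatM.szpiroBad` (p483052) · W-num-6's template `not_hSHwBad_M_of_reyssat_thirteen_inputs` (p479897); (5) the d_mod = 1 closure
`GenuineKSlot.cor312PerImageOf_of_not_slotLicence_of_orNum_of_dmod_eq_one` (p479622, C-R69′). Proof = the tuple of those theorems; proves nothing new; «refuted as typed» ≠ «in print»; (P6) is classical; no side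
taken. [claim: Mochizuki2012, status: disputed] -/
theorem apex_status_v15 :
    StatementOf @Summit.ABC.IUTFork.DAG.apex_status_v14 ∧
    -- §Q (1): (P6) at the Reyssat triple is a theorem
    (StatementOf @Summit.ABC.IUTFork.Conditional.FreyP6Reyssat.condP6_thirteen ∧
      StatementOf @Summit.ABC.IUTFork.Conditional.FreyP6Reyssat.condP6_seventeen ∧
      StatementOf @Summit.ABC.IUTFork.Conditional.FreyP6Reyssat.condP6_nineteen ∧
      StatementOf @Summit.ABC.IUTFork.Conditional.FreyP6Reyssat.condP6_reyssat_of_le_149) ∧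
    -- §Q (2)(3): the M window binder refuted modulo (P6), and with no hypothesis
    (StatementOf @Summit.ABC.IUTFork.Conditional.not_hSHwBad_M_reyssat_thirteen ∧
      StatementOf @Summit.ABC.IUTFork.Conditional.not_hSHwBad_M_reyssat_thirteen_holds) ∧
    -- §Q (4): the inputs by name
    (StatementOf @Summit.ABC.IUTFork.Conditional.ReyssatM.not_exists_deep_thirteen ∧
      StatementOf @Summit.ABC.IUTFork.Conditional.GenuineM.not_pilotKummerCompatHull_reyssat_le_19_rad ∧
      StatementOf @Summit.ABC.IUTFork.Conditional.ReyssatM.szpiroBad ∧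
      StatementOf @Summit.ABC.IUTFork.Conditional.not_hSHwBad_M_of_reyssat_thirteen_inputs) ∧
    -- §Q (5): d_mod = 1 picture closed (C-R69′)
    StatementOf @Summit.ABC.IUTFork.Conditional.GenuineKSlot.cor312PerImageOf_of_not_slotLicence_of_orNum_of_dmod_eq_one :=
  ⟨@Summit.ABC.IUTFork.DAG.apex_status_v14,
    ⟨@Summit.ABC.IUTFork.Conditional.FreyP6Reyssat.condP6_thirteen, @Summit.ABC.IUTFork.Conditional.FreyP6Reyssat.condP6_seventeen,
      @Summit.ABC.IUTFork.Conditional.FreyP6Reyssat.condP6_nineteen, @Summit.ABC.IUTFork.Conditional.FreyP6Reyssat.condP6_reyssat_of_le_149⟩,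
    ⟨@Summit.ABC.IUTFork.Conditional.not_hSHwBad_M_reyssat_thirteen, @Summit.ABC.IUTFork.Conditional.not_hSHwBad_M_reyssat_thirteen_holds⟩,
    ⟨@Summit.ABC.IUTFork.Conditional.ReyssatM.not_exists_deep_thirteen,
      @Summit.ABC.IUTFork.Conditional.GenuineM.not_pilotKummerCompatHull_reyssat_le_19_rad,
      @Summit.ABC.IUTFork.Conditional.ReyssatM.szpiroBad,
      @Summit.ABC.IUTFork.Conditional.not_hSHwBad_M_of_reyssat_thirteen_inputs⟩,
    @Summit.ABC.IUTFork.Conditional.GenuineKSlot.cor312PerImageOf_of_not_slotLicence_of_orNum_of_dmod_eq_one⟩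

/-- Δ23 corollary, BY NAME: the K and the M window binders of the cell's v10K / v11M window certificates are BOTH refuted as typed with NO hypothesis,
each at a genuine datum of a known abc triple — `not_hSHwBad_frey_holds` (K, λ₃₆₇₇, p477209; §P) and `not_hSHwBad_M_reyssat_thirteen_holds` (M, Reyssat,
p483704; §Q) — recorded under one name for letter-K2 readers. Proves nothing new; refuted-as-typed ≠ refuted-in-print; no side taken.
[claim: Mochizuki2012, status: disputed] -/
theorem apex_status_v15_window_binders_K_and_M_refuted_as_typed :
    StatementOf @Summit.ABC.IUTFork.Conditional.not_hSHwBad_frey_holds ∧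
      StatementOf @Summit.ABC.IUTFork.Conditional.not_hSHwBad_M_reyssat_thirteen_holds :=
  ⟨apex_status_v14_window_refuted_as_typed.1, apex_status_v15.2.2.1.2⟩

end Summit.ABC.IUTFork.DAG

end
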